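import Summits.HodgeConjecture.CorCM.PairFlipCompanionRealSubfield
import HarnessLib

/-!
# The `(4,4)` cell over a common totally real quartic field, and pairs of generic CM abelian varieties of any dimension
# over one totally real field

COR-CM (cell `pub-hodgecm2`, binder seat `b16` gen 51, count-neutral claim PAIRFLIP-COMPANION, file F4 — abelian
varieties; theorems only, no definition, no named fact, no `sorry`).  NEW as stated, hence under `Summits/`.  HONEST
FRAMING: «HC for NAMED classes» / «exceptional classes for NAMED classes» statements, unconditional, kernel; `HC_CM` is
neither used nor asserted.

SETTING (F3 `PairFlipCompanionRealSubfield`).  `F` totally real, `K_{i₀} ⊇ e₀(F)`, `K_{i₁} ⊇ e₁(F)` CM fields with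
`[K_{i₀}:ℚ] = [K_{i₁}:ℚ] = 2[F:ℚ]`, `K_{i₀}` with PAIR FLIPS (generic: Galois closure ⊇ the full sign group `(ℤ/2)ⁿ`),
`A_{i₀}`, `A_{i₁}` non-isogenous realisations of types `Φ_{i₀}`, `Φ_{i₁}`, `I = {i₀, i₁}`.

* §1 ANY dimension, BOTH fields generic: **`hodgeConjectureFor_prod_pairFlip_pair_of_ringHom_real`** — two non-isogenous
  CM abelian varieties with pair-flip CM fields over ONE totally real field (same field, companion fields `F(√−α)`,
  `F(√−αD)`, `F(√−αN)`, …, inside or outside each other's Galois closure): the Hodge conjecture with `B• = D•` on every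
  `A₀^a × A₁^b`, UNCONDITIONALLY (`isNondegenerateFamily_pairFlip_pair_of_ringHom_real`; for simple = all such realisations
  `not_exists_exceptional_prod_pairFlip_pair_of_ringHom_real`).  The tree had this for sextic fields
  (`GenericSexticThreefoldPairsHodge`, via the six-point combinatorics) and for distinct closures in any degree
  (`PairFlipCMFieldsSplitOffHodge`); the same-closure companions of degree `≥ 8` are new.
* §2 THE `(4,4)` CELL OVER A COMMON REAL QUARTIC FIELD: `F₀ = A_{i₀}` a simple CM fourfold with pair-flip octic field
  (sign kernel `16`: closures of degree `64, 128, 192, 384`), `F₁ = A_{i₁}` ANY simple CM fourfold whose octic field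
  contains the same totally real quartic `F` (any closure, any sign kernel, with or without imaginary quadratic or quartic
  CM subfields): **`forall_prod_isDivisorGenerated_iff_fourfolds_of_pairFlip_of_ringHom_real`** — `B• = D•` on ALL
  `F₀^a × F₁^b` ⟺ `B•(F₁) = D•(F₁)` (⟺ `F₁` carries no Weil-type class in `H⁴`, Moonen–Zarhin (0.1) (b));
  **`hodgeConjectureFor_prod_fourfolds_of_pairFlip_of_ringHom_real`** — then the Hodge conjecture on every
  `F₀^a × F₁^b`, UNCONDITIONALLY; **`exists_exceptional_prod_iff_fourfolds_of_pairFlip_of_ringHom_real`** — otherwise the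
  exceptional classes on the products are accounted for by `F₁` alone.  With the tree's `(4,4)` results (shared
  imaginary quadratic field, common quartic CM subfield `CommonQuarticCMSubfield*`, distinct closures
  `PairFlipCMFieldOffClosureHodge`) this settles every pair of simple CM fourfolds one of which is generic and which
  share the maximal real subfield.

## References

* [MoonenZarhin1999LowDim] B. Moonen, Yu. Zarhin, *Hodge classes on abelian varieties of low dimension*, Math. Ann. 315
  (1999), Thm. (0.1) (b), (2.4)–(2.5).
* [Gordon1999HodgeAVSurvey] B. B. Gordon, *A survey of the Hodge conjecture for abelian varieties*, §3 Theorem, 5.13,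
  7.4–7.7, 10.10.
* [Dodson1984] B. Dodson, *The structure of Galois groups of CM-fields*, Trans. AMS 283 (1984), §1.1, §3.3.2, §5.1.2.
-/

noncomputable section

open CategoryTheory CategoryTheory.Limits NumberField Module IntermediateField

namespace Summit.HodgeConjecture.CorCM

open Literature.NumberTheory.ComplexMultiplication
open Literature.AlgebraicGeometry.Motives (AbelianVariety CMType)
open Literature.AlgebraicGeometry.HodgeTheory
open Literature.AlgebraicGeometry.ComplexMultiplication (IsCMTypeRealisation isSimple_iff_isPrimitive)
open Literature.AlgebraicGeometry.VanGeemen1994 (hodgeClassSpan)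
open Literature.AlgebraicGeometry.Pohlmann1968
open Literature.Barriers.HodgeConjecture (divisorClassesSpan)

variable {I : Type} {K : I → Type} [∀ i, Field (K i)] [∀ i, NumberField (K i)] [∀ i, IsCMField (K i)] [Fintype I]
  [DecidableEq I] [Nonempty I] {Φ : ∀ i, CMType (K i)}
  {F : Type} [Field F] [NumberField F] [IsTotallyReal F]
  {A : I → AbelianVariety ℂ} {ι : ∀ i, 𝓞 (K i) →+* End (A i)} {θ : ∀ i, K i →+* Module.End ℂ (complexBetti (A i).X 1)}

/-! ## §1 Two generic CM abelian varieties over one totally real field -/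

section BothGeneric

/-- **Two non-isogenous CM abelian varieties with pair-flip CM fields over one totally real field form a nondegenerate
pair** (`Hg(A₀ × A₁) = Hg(A₀) × Hg(A₁)`, both of full rank): the partner type is nondegenerate by its own pair flips.
[cite: Gordon1999HodgeAVSurvey, §3 Theorem and 7.5] [cite: Dodson1984, §5.1.2] -/
theorem isNondegenerateFamily_pairFlip_pair_of_ringHom_real {i₀ i₁ : I} (hI : ∀ j, j = i₀ ∨ j = i₁)
    (hflip₀ : ∀ s : K i₀ →+* ℂ, ∃ σ : ℂ ≃+* ℂ, σ • s = (starRingAut : ℂ ≃+* ℂ) • s ∧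
      ∀ t : K i₀ →+* ℂ, t ≠ s → t ≠ (starRingAut : ℂ ≃+* ℂ) • s → σ • t = t)
    (hflip₁ : ∀ s : K i₁ →+* ℂ, ∃ σ : ℂ ≃+* ℂ, σ • s = (starRingAut : ℂ ≃+* ℂ) • s ∧
      ∀ t : K i₁ →+* ℂ, t ≠ s → t ≠ (starRingAut : ℂ ≃+* ℂ) • s → σ • t = t)
    (e₀ : F →+* K i₀) (e₁ : F →+* K i₁) (hF₀ : finrank ℚ (K i₀) = 2 * finrank ℚ F)
    (hF₁ : finrank ℚ (K i₁) = 2 * finrank ℚ F) (hA : ∀ i, IsCMTypeRealisation (Φ i) (A i) (ι i) (θ i))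
    (hniso : ∀ i j, i ≠ j → ¬ AbelianVariety.IsIsogenous (A i) (A j)) : CMAlgebra.IsNondegenerateFamily Φ :=
  (isNondegenerateFamily_iff_of_pairFlip_of_ringHom_real_of_not_isIsogenous hI hflip₀ e₀ e₁ hF₀ hF₁ hA hniso).2
    (irreducible_and_finrank_eq_of_pairFlip (Φ := Φ) hflip₁).2.2

/-- **The Hodge conjecture on every `A₀^a × A₁^b` for two non-isogenous CM abelian varieties of any dimension whose CM
fields are generic (pair flips) over ONE totally real field** — with `B• = D•` there, UNCONDITIONALLY; the fields may be
equal, isomorphic, companions in one Galois closure, or have different closures.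
[cite: Gordon1999HodgeAVSurvey, 7.5 and 10.10] [cite: Dodson1984, §5.1.2] -/
theorem hodgeConjectureFor_prod_pairFlip_pair_of_ringHom_real {i₀ i₁ : I} (hI : ∀ j, j = i₀ ∨ j = i₁)
    (hflip₀ : ∀ s : K i₀ →+* ℂ, ∃ σ : ℂ ≃+* ℂ, σ • s = (starRingAut : ℂ ≃+* ℂ) • s ∧
      ∀ t : K i₀ →+* ℂ, t ≠ s → t ≠ (starRingAut : ℂ ≃+* ℂ) • s → σ • t = t)
    (hflip₁ : ∀ s : K i₁ →+* ℂ, ∃ σ : ℂ ≃+* ℂ, σ • s = (starRingAut : ℂ ≃+* ℂ) • s ∧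
      ∀ t : K i₁ →+* ℂ, t ≠ s → t ≠ (starRingAut : ℂ ≃+* ℂ) • s → σ • t = t)
    (e₀ : F →+* K i₀) (e₁ : F →+* K i₁) (hF₀ : finrank ℚ (K i₀) = 2 * finrank ℚ F)
    (hF₁ : finrank ℚ (K i₁) = 2 * finrank ℚ F) (hA : ∀ i, IsCMTypeRealisation (Φ i) (A i) (ι i) (θ i))
    (hniso : ∀ i j, i ≠ j → ¬ AbelianVariety.IsIsogenous (A i) (A j)) {N : ℕ} (π : Fin N → I) :
    HodgeConjectureFor (⨁ fun j : Fin N => A (π j)).dim (⨁ fun j : Fin N => A (π j)).X ∧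
      ∀ m : ℕ, hodgeClassSpan (⨁ fun j : Fin N => A (π j)).dim (⨁ fun j : Fin N => A (π j)).X m =
        divisorClassesSpan (⨁ fun j : Fin N => A (π j)).X (⨁ fun j : Fin N => A (π j)).dim m :=
  have h := isNondegenerateFamily_pairFlip_pair_of_ringHom_real hI hflip₀ hflip₁ e₀ e₁ hF₀ hF₁ hA hniso
  ⟨h.hodgeConjectureFor_prod hA π, fun m => h.hodgeClassSpan_prod_eq_divisorClassesSpan hA π m⟩

/-- **No exceptional Hodge class on any `A₀^a × A₁^b`** for two non-isogenous CM abelian varieties with generic CM fields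
over one totally real field. [cite: Gordon1999HodgeAVSurvey, 7.5 (1) ⟹ (3)] -/
theorem not_exists_exceptional_prod_pairFlip_pair_of_ringHom_real {i₀ i₁ : I} (hI : ∀ j, j = i₀ ∨ j = i₁)
    (hflip₀ : ∀ s : K i₀ →+* ℂ, ∃ σ : ℂ ≃+* ℂ, σ • s = (starRingAut : ℂ ≃+* ℂ) • s ∧
      ∀ t : K i₀ →+* ℂ, t ≠ s → t ≠ (starRingAut : ℂ ≃+* ℂ) • s → σ • t = t)
    (hflip₁ : ∀ s : K i₁ →+* ℂ, ∃ σ : ℂ ≃+* ℂ, σ • s = (starRingAut : ℂ ≃+* ℂ) • s ∧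
      ∀ t : K i₁ →+* ℂ, t ≠ s → t ≠ (starRingAut : ℂ ≃+* ℂ) • s → σ • t = t)
    (e₀ : F →+* K i₀) (e₁ : F →+* K i₁) (hF₀ : finrank ℚ (K i₀) = 2 * finrank ℚ F)
    (hF₁ : finrank ℚ (K i₁) = 2 * finrank ℚ F) (hA : ∀ i, IsCMTypeRealisation (Φ i) (A i) (ι i) (θ i))
    (hniso : ∀ i j, i ≠ j → ¬ AbelianVariety.IsIsogenous (A i) (A j)) :
    ¬ ∃ (N : ℕ) (π : Fin N → I) (m : ℕ) (c : complexBetti (⨁ fun j : Fin N => A (π j)).X (2 * m)),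
      IsRationalClass c ∧
      IsOfHodgeType (⨁ fun j : Fin N => A (π j)).dim (⨁ fun j : Fin N => A (π j)).X (2 * m) m m c ∧
      c ∉ divisorClassesSpan (⨁ fun j : Fin N => A (π j)).X (⨁ fun j : Fin N => A (π j)).dim m := by
  rintro ⟨N, π, m, c, hcQ, hcH, hcD⟩
  have h := isNondegenerateFamily_pairFlip_pair_of_ringHom_real hI hflip₀ hflip₁ e₀ e₁ hF₀ hF₁ hA hniso
  exact hcD (by
    rw [← h.hodgeClassSpan_prod_eq_divisorClassesSpan hA π m]
    exact Submodule.subset_span ⟨hcQ, hcH⟩)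

end BothGeneric

/-! ## §2 The `(4,4)` cell over a common totally real quartic field -/

section Fourfolds

/-- **THE `(4,4)` CELL OVER A COMMON REAL QUARTIC FIELD.**  `F₀ = A_{i₀}` a CM fourfold whose octic CM field has pair
flips, `F₁ = A_{i₁}` a SIMPLE CM fourfold whose octic field receives the same totally real quartic `F`, the two not
isogenous.  Then `Hg(F₀ × F₁) = Hg(F₀) × Hg(F₁)` (the family is nondegenerate) **iff `B•(F₁) = D•(F₁)`** — iff `F₁`
carries no Weil-type exceptional class (Moonen–Zarhin: for a simple CM fourfold the only possible exceptional classes sit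
in `H⁴` and come from an imaginary quadratic subfield acting with multiplicities `(2,2)`).
[cite: MoonenZarhin1999LowDim, Thm. (0.1) (b) and (2.4)–(2.5)] [cite: Gordon1999HodgeAVSurvey, 5.13, 7.5–7.7] -/
theorem isNondegenerateFamily_iff_isDivisorGenerated_fourfolds_of_pairFlip_of_ringHom_real {i₀ i₁ : I}
    (hI : ∀ j, j = i₀ ∨ j = i₁)
    (hflip : ∀ s : K i₀ →+* ℂ, ∃ σ : ℂ ≃+* ℂ, σ • s = (starRingAut : ℂ ≃+* ℂ) • s ∧
      ∀ t : K i₀ →+* ℂ, t ≠ s → t ≠ (starRingAut : ℂ ≃+* ℂ) • s → σ • t = t)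
    (e₀ : F →+* K i₀) (e₁ : F →+* K i₁) (hF : finrank ℚ F = 4) (h8₀ : finrank ℚ (K i₀) = 8)
    (h8₁ : finrank ℚ (K i₁) = 8) (hA : ∀ i, IsCMTypeRealisation (Φ i) (A i) (ι i) (θ i))
    (hS : (A i₁).IsSimple) (hniso : ∀ i j, i ≠ j → ¬ AbelianVariety.IsIsogenous (A i) (A j)) :
    CMAlgebra.IsNondegenerateFamily Φ ↔ IsDivisorGenerated (A i₁) := by
  obtain ⟨φ₀⟩ : Nonempty (K i₁ →+* ℂ) := inferInstance
  rw [isNondegenerateFamily_iff_of_pairFlip_of_ringHom_real_of_not_isIsogenous hI hflip e₀ e₁ (by rw [h8₀, hF])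
    (by rw [h8₁, hF]) hA hniso,
    isDivisorGenerated_iff_isNondegenerate_of_finrank_eq_eight h8₁ φ₀ ((isSimple_iff_isPrimitive (hA i₁) φ₀).1 hS) (hA i₁)]

/-- **`B• = D•` on ALL `F₀^a × F₁^b` iff `B•(F₁) = D•(F₁)`** for the `(4,4)` cell over a common real quartic field (`F₀`
generic, `F₁` any simple CM fourfold over the same `F`, both simple, not isogenous): in the divisor-generated case no
product carries an exceptional class; otherwise already `F₁` does.
[cite: MoonenZarhin1999LowDim, Thm. (0.1) (b)] [cite: Gordon1999HodgeAVSurvey, 7.5 and 7.6.1] -/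
theorem forall_prod_isDivisorGenerated_iff_fourfolds_of_pairFlip_of_ringHom_real {i₀ i₁ : I}
    (hI : ∀ j, j = i₀ ∨ j = i₁)
    (hflip : ∀ s : K i₀ →+* ℂ, ∃ σ : ℂ ≃+* ℂ, σ • s = (starRingAut : ℂ ≃+* ℂ) • s ∧
      ∀ t : K i₀ →+* ℂ, t ≠ s → t ≠ (starRingAut : ℂ ≃+* ℂ) • s → σ • t = t)
    (e₀ : F →+* K i₀) (e₁ : F →+* K i₁) (hF : finrank ℚ F = 4) (h8₀ : finrank ℚ (K i₀) = 8)
    (h8₁ : finrank ℚ (K i₁) = 8) (hA : ∀ i, IsCMTypeRealisation (Φ i) (A i) (ι i) (θ i))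
    (hS : ∀ i, (A i).IsSimple) (hniso : ∀ i j, i ≠ j → ¬ AbelianVariety.IsIsogenous (A i) (A j)) :
    (∀ (N : ℕ) (π : Fin N → I), IsDivisorGenerated (⨁ fun j : Fin N => A (π j))) ↔ IsDivisorGenerated (A i₁) := by
  have hcrit := isNondegenerateFamily_iff_isDivisorGenerated_fourfolds_of_pairFlip_of_ringHom_real hI hflip e₀ e₁ hF
    h8₀ h8₁ hA (hS i₁) hniso
  constructor
  · intro h
    by_contra hF₁
    have hfam : ¬ CMAlgebra.IsNondegenerateFamily Φ := fun hf => hF₁ (hcrit.1 hf)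
    obtain ⟨N, π, m, c, hcQ, hcH, hcD⟩ := CMAlgebra.exists_exceptional_prod_of_not_isNondegenerateFamily
      (CMAlgebra.isSeparatingFamily_of_isSimple_of_pairwise_not_isIsogenous hA hS hniso) hfam hA
    exact hcD (h N π m c hcQ hcH)
  · intro hF₁ N π m c hcQ hcH
    have hnd : CMAlgebra.IsNondegenerateFamily Φ := hcrit.2 hF₁
    rw [← hnd.hodgeClassSpan_prod_eq_divisorClassesSpan hA π m]
    exact Submodule.subset_span ⟨hcQ, hcH⟩

/-- **The Hodge conjecture on every `F₀^a × F₁^b`** for a CM fourfold `F₀` with pair-flip octic field and a simple CM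
fourfold `F₁` over the same totally real quartic field which is divisor-generated (no Weil classes), not isogenous to
`F₀` — with `B• = D•` there, UNCONDITIONALLY; no hypothesis on the Galois closure or the sign group of the octic field
of `F₁`. [cite: MoonenZarhin1999LowDim, Thm. (0.1) (b) and (4)] [cite: Gordon1999HodgeAVSurvey, 10.10] -/
theorem hodgeConjectureFor_prod_fourfolds_of_pairFlip_of_ringHom_real {i₀ i₁ : I} (hI : ∀ j, j = i₀ ∨ j = i₁)
    (hflip : ∀ s : K i₀ →+* ℂ, ∃ σ : ℂ ≃+* ℂ, σ • s = (starRingAut : ℂ ≃+* ℂ) • s ∧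
      ∀ t : K i₀ →+* ℂ, t ≠ s → t ≠ (starRingAut : ℂ ≃+* ℂ) • s → σ • t = t)
    (e₀ : F →+* K i₀) (e₁ : F →+* K i₁) (hF : finrank ℚ F = 4) (h8₀ : finrank ℚ (K i₀) = 8)
    (h8₁ : finrank ℚ (K i₁) = 8) (hA : ∀ i, IsCMTypeRealisation (Φ i) (A i) (ι i) (θ i))
    (hS : (A i₁).IsSimple) (hniso : ∀ i j, i ≠ j → ¬ AbelianVariety.IsIsogenous (A i) (A j))
    (hD : IsDivisorGenerated (A i₁)) {N : ℕ} (π : Fin N → I) :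
    HodgeConjectureFor (⨁ fun j : Fin N => A (π j)).dim (⨁ fun j : Fin N => A (π j)).X ∧
      ∀ m : ℕ, hodgeClassSpan (⨁ fun j : Fin N => A (π j)).dim (⨁ fun j : Fin N => A (π j)).X m =
        divisorClassesSpan (⨁ fun j : Fin N => A (π j)).X (⨁ fun j : Fin N => A (π j)).dim m :=
  have h := (isNondegenerateFamily_iff_isDivisorGenerated_fourfolds_of_pairFlip_of_ringHom_real hI hflip e₀ e₁ hF h8₀
    h8₁ hA hS hniso).2 hD
  ⟨h.hodgeConjectureFor_prod hA π, fun m => h.hodgeClassSpan_prod_eq_divisorClassesSpan hA π m⟩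

/-- **Exceptional classes in the `(4,4)` cell over a common real quartic field**: for `F₀` generic and `F₁` simple over
the same `F`, both simple and not isogenous, SOME `F₀^a × F₁^b` carries an exceptional Hodge class iff `F₁` is NOT
divisor-generated — iff `F₁` itself carries a Weil-type class in `H⁴`; `F₀` contributes nothing new.
[cite: MoonenZarhin1999LowDim, Thm. (0.1) (b)] [cite: Gordon1999HodgeAVSurvey, 7.5 and 7.6.1] -/
theorem exists_exceptional_prod_iff_fourfolds_of_pairFlip_of_ringHom_real {i₀ i₁ : I} (hI : ∀ j, j = i₀ ∨ j = i₁)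
    (hflip : ∀ s : K i₀ →+* ℂ, ∃ σ : ℂ ≃+* ℂ, σ • s = (starRingAut : ℂ ≃+* ℂ) • s ∧
      ∀ t : K i₀ →+* ℂ, t ≠ s → t ≠ (starRingAut : ℂ ≃+* ℂ) • s → σ • t = t)
    (e₀ : F →+* K i₀) (e₁ : F →+* K i₁) (hF : finrank ℚ F = 4) (h8₀ : finrank ℚ (K i₀) = 8)
    (h8₁ : finrank ℚ (K i₁) = 8) (hA : ∀ i, IsCMTypeRealisation (Φ i) (A i) (ι i) (θ i))
    (hS : ∀ i, (A i).IsSimple) (hniso : ∀ i j, i ≠ j → ¬ AbelianVariety.IsIsogenous (A i) (A j)) :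
    (∃ (N : ℕ) (π : Fin N → I) (m : ℕ) (c : complexBetti (⨁ fun j : Fin N => A (π j)).X (2 * m)),
      IsRationalClass c ∧
      IsOfHodgeType (⨁ fun j : Fin N => A (π j)).dim (⨁ fun j : Fin N => A (π j)).X (2 * m) m m c ∧
      c ∉ divisorClassesSpan (⨁ fun j : Fin N => A (π j)).X (⨁ fun j : Fin N => A (π j)).dim m) ↔
      ¬ IsDivisorGenerated (A i₁) := by
  obtain ⟨φ₀⟩ : Nonempty (K i₁ →+* ℂ) := inferInstance
  rw [isDivisorGenerated_iff_isNondegenerate_of_finrank_eq_eight h8₁ φ₀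
    ((isSimple_iff_isPrimitive (hA i₁) φ₀).1 (hS i₁)) (hA i₁)]
  exact exists_exceptional_prod_iff_of_pairFlip_of_ringHom_real hI hflip e₀ e₁ (by rw [h8₀, hF]) (by rw [h8₁, hF])
    hA hS hniso

/-- **Maximal-real-subfield form of the `(4,4)` cell**: `F₀` with pair-flip octic field `K_{i₀}`, `F₁` simple with octic
field `K_{i₁}` whose maximal real subfield embeds in `K_{i₀}`, not isogenous: the Hodge conjecture with `B• = D•` on every
`F₀^a × F₁^b` as soon as `F₁` is divisor-generated. [cite: MoonenZarhin1999LowDim, Thm. (0.1) (b)]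
[cite: Gordon1999HodgeAVSurvey, 10.10] -/
theorem hodgeConjectureFor_prod_fourfolds_of_pairFlip_of_maximalRealSubfield {i₀ i₁ : I} (hI : ∀ j, j = i₀ ∨ j = i₁)
    (hflip : ∀ s : K i₀ →+* ℂ, ∃ σ : ℂ ≃+* ℂ, σ • s = (starRingAut : ℂ ≃+* ℂ) • s ∧
      ∀ t : K i₀ →+* ℂ, t ≠ s → t ≠ (starRingAut : ℂ ≃+* ℂ) • s → σ • t = t)
    (e : maximalRealSubfield (K i₁) →+* K i₀) (h8₀ : finrank ℚ (K i₀) = 8) (h8₁ : finrank ℚ (K i₁) = 8)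
    (hA : ∀ i, IsCMTypeRealisation (Φ i) (A i) (ι i) (θ i)) (hS : (A i₁).IsSimple)
    (hniso : ∀ i j, i ≠ j → ¬ AbelianVariety.IsIsogenous (A i) (A j)) (hD : IsDivisorGenerated (A i₁)) {N : ℕ}
    (π : Fin N → I) :
    HodgeConjectureFor (⨁ fun j : Fin N => A (π j)).dim (⨁ fun j : Fin N => A (π j)).X ∧
      ∀ m : ℕ, hodgeClassSpan (⨁ fun j : Fin N => A (π j)).dim (⨁ fun j : Fin N => A (π j)).X m =
        divisorClassesSpan (⨁ fun j : Fin N => A (π j)).X (⨁ fun j : Fin N => A (π j)).dim m := by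
  have h4 : finrank ℚ (maximalRealSubfield (K i₁)) = 4 := by
    have := finrank_eq_two_mul_finrank_maximalRealSubfield (K := K) i₁
    omega
  exact hodgeConjectureFor_prod_fourfolds_of_pairFlip_of_ringHom_real hI hflip e (maximalRealSubfield (K i₁)).subtype
    h4 h8₀ h8₁ hA hS hniso hD π

end Fourfolds

end Summit.HodgeConjecture.CorCM

end
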